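import Literature.NumberTheory.LFunctions.CriticalLineTwoThirdsWindowDecay
import Literature.NumberTheory.LFunctions.CriticalLineTwoThirdsExplicitFormula
import Literature.NumberTheory.LFunctions.ZetaZeroKernelSumsExplicit
import Literature.NumberTheory.LFunctions.ZetaZerosProofs
import HarnessLib

/-!
# RH-FREE — «nothing here bears on the truth of RH»: Alpöge–Furman 2026 (arXiv:2608.13637) Proposition 4.3 (Tail) — the Gabor mass of the zeros NOT seen by the window is `≪ T^{−1/2}` — PROVED (partial-sum form, typed model)

Topic `Literature/NumberTheory/LFunctions` (namespace `Literature.NumberTheory.LFunctions.AlpogeFurman2026`).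
Cell `rh-columns/lit`, unit `rh-lit-frontier-1` (gen 7). Source: **[AF26]** L. Alpöge, R. Furman,
*More than two thirds of the zeros of the Riemann zeta function are simple and on the critical
line*, arXiv:2608.13637v2 (19 Aug 2026), UNREFEREED preprint (D-0012); locators = printed
proposition / equation numbers and pages of v2 (running heads). This file has NO definition, NO claim
and NO `sorry`; it is a proof layer over `CriticalLineTwoThirdsMatrix.lean` (typed `φ_T = phi ψ T`,
grid `α_k = grid T L k`, `d = gridDim T`, window `I′ ↔ nearZeros T`, `γ_ρ = gammaOf ρ`) and
`CriticalLineTwoThirdsWindowDecay.lean` (second-order decay (2.8)).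

## What the source prints (p. 7)

**Proposition 4.3 (Tail).** "`‖Ẽ‖₁ ≪_χ T^{−1/2}`; in particular `‖Ẽ‖, ‖Ẽ‖_HS ≤ ‖Ẽ‖₁ = o(1)`."
*Proof.* "Since `‖v_ρ v_ρᵀ‖₁ = ‖v_ρ‖₂²`, `‖Ẽ‖₁ ≤ (aL²)⁻¹ Σ_{Re γ_ρ ∉ I′} m_ρ ‖v_ρ‖₂²`. For such `ρ`,
`D := dist(Re γ_ρ, I) ≥ D₀ = √T`, and as above `‖v_ρ‖₂² ≤ e^{L/2} C_χ² · h⁻¹ D⁻³ ≪ X^{1/2} L D⁻³`.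
By `N(t, t+1) ≪ log(|t|+3)` [Tit86, Thm 9.2],
`Σ_{Re γ_ρ ∉ I′} m_ρ D⁻³ ≪ L ∫_{√T}^{T} D⁻³ dD + Σ_{|γ|>3T} log|γ|/|γ|³ ≪ L T⁻¹`.
Hence `‖Ẽ‖₁ ≪ (aL²)⁻¹ · X^{1/2} L · L T⁻¹ ≪ X^{1/2} T⁻¹ ≪ T^{−1/2}`." Here (§2.3, pp. 4–5) `X = T/2π`,
`L = log X`, `h = 2π/L`, `I = [T, 2T]`, `I′ = [T − √T, 2T + √T]`, `α_k = T + kh` (`0 ≤ k < d`),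
`(v_ρ)_k = φ̂(γ_ρ − α_k)`, `Ẽ := (aL²)⁻¹ Σ_{Re γ_ρ ∉ I′} m_ρ v_ρ v_ρᵀ`.

## What is proved here (the printed bound, for every finite truncation of the sum defining `Ẽ`)

* `AlpogeFurman2026_tail_partial_sum` — for a window `ψ` there is `C ≥ 0` such that for all
  `T ≥ 300` with `L ≥ 10` and every finite set `F` of distinct non-trivial zeros with `ρ ∉ nearZeros T`
  (`Im ρ < T − √T` or `Im ρ ≥ 2T + √T`):
  `Σ_{ρ∈F} m_ρ Σ_{0≤k<d} |φ̂_T(γ_ρ − α_k)|² ≤ C L²/√T`;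
* `AlpogeFurman2026_tail_partial_sum_normalised` — the same divided by the normalisation
  `L ∫φ_T² = aL²` of (2.10): `≤ C/√T`, i.e. `‖Ẽ‖₁ ≪ T^{−1/2}` on partial sums (the trace norm of a
  sum of the rank-one positive forms `m_ρ v_ρ v̄_ρᵀ` is the sum of `m_ρ ‖v_ρ‖₂²`).

The constant is `480 C²` with `C` the second-order decay constant of
`exists_norm_hat_phi_le_inv_sq'`; the threshold `T ≥ 300, L ≥ 10` is the one already used by the
trace layer (`CriticalLineTwoThirdsTraceProofs`).

## How (the printed route, with the zero count made explicit)

* §1 Shifted Cauchy-kernel sums over zeros WITH multiplicity: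
  `Σ_{ρ∈F} m_ρ/(1 + (u₀ − Im ρ + d)²) ≤ 24 log(u₀+2)/(d+1)` for zeros below `u₀`, the analogue above
  `u₀`, and the negative-ordinate case by conjugation — the tree's `Montgomery.sum_below_le /
  sum_above_le` (window count `N(t,t+1] ≤ 3 log(t+2)`, `zetaZeroCount_window_le_three_log`) through
  the ordinate dictionary `OrdinateDictionary.sum_zetaZeroBox_mul_eq_sum_range` (which carries the
  multiplicities). This is the "`N(t, t+1) ≪ log(|t|+3)`" step.
* §2 Per-zero Gabor mass far from the window: from `|φ̂_T(ξ+iy)| ≤ C e^{L|y|/2}/(ξ²+y²)` and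
  `|Im γ_ρ| ≤ ½`, for `Re z` at distance `≥ D ≥ 1` to the left of `T` (resp. to the right of `2T`,
  using `d h ≤ T`), `Σ_{0≤k<d} |φ̂_T(z − α_k)|² ≤ (C² e^{L|Im z|}/D²)(1/D² + 1/(hD))`
  (`sum_inv_sq_arith_le`) — the printed `‖v_ρ‖₂² ≪ e^{L/2} C² h⁻¹ D⁻³`, kept with one spare power of `D`.
* §3 Assembly at `T ≥ 300`, `L ≥ 10`: `e^{L/2} = √X ≤ √T`, far zeros have `D ≥ √T`, so each far zero
  carries `≤ 2C²L/(1 + D_ρ²)`; summing with §1 over the three ranges (`0 < Im ρ < T − √T`,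
  `Im ρ ≥ 2T + √T`, `Im ρ < 0`) gives `≤ 2C²L · 240 L/√T`.

STATUS NOTE (no endorsement). Unconditional, elementary given the tree's explicit zero counting and
the decay file; it is one input (of five: Propositions 4.3, 5.2–5.5) to [AF26]'s Theorem 5.7, whose
typed form `AlpogeFurman2026_hilbertSchmidt` remains a CLAIM of an unrefereed preprint; nothing here
asserts it, Theorem A, or anything about RH.

## References
* [AlpogeFurman2026] as above, Proposition 4.3 (p. 7); §2.3 (pp. 4–5) for `I′, v_ρ, Ẽ`; eq. (2.8) (p. 4).
* [Titchmarsh1986] E. C. Titchmarsh, *The theory of the Riemann zeta-function*, 2nd ed. (OUP 1986),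
  Theorem 9.2 (`N(T+1) − N(T) = O(log T)`) — here via the tree's explicit `zetaZeroCount_window_le_three_log`.
-/

noncomputable section

open Complex Filter Set MeasureTheory
open scoped Real Topology ComplexConjugate

namespace Literature.NumberTheory.LFunctions

namespace AlpogeFurman2026

/-! ## §1. Shifted Cauchy-kernel sums over zeros, WITH multiplicity -/

/-- **Zeros below a point, with multiplicity**: for `0 ≤ u₀`, `0 ≤ d` and any finite set `F` of
distinct non-trivial zeros with `0 < Im ρ ≤ u₀`,
`Σ_{ρ∈F} m(ρ)/(1 + (u₀ − Im ρ + d)²) ≤ 24 log(u₀+2)/(d+1)` (the tree's `Montgomery.sum_below_le` with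
the explicit window constant `C₀ = 3`, through the ordinate dictionary). This is the
"`N(t, t+1) ≪ log(|t|+3)`" step of [AF26] Proposition 4.3. [cite: AlpogeFurman2026, Proposition 4.3 (proof), p. 7] -/
theorem sum_order_div_kernel_below_le {u₀ d : ℝ} (hu₀ : 0 ≤ u₀) (hd : 0 ≤ d) (F : Finset ℂ)
    (hF : ∀ ρ ∈ F, ρ ∈ ZetaZeros.riemannZetaNontrivialZeros ∧ 0 < ρ.im ∧ ρ.im ≤ u₀) :
    ∑ ρ ∈ F, (riemannZetaZeroOrder ρ : ℝ) / (1 + (u₀ - ρ.im + d) ^ 2) ≤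
      24 * Real.log (u₀ + 2) / (d + 1) := by
  classical
  have hW := zetaZeroCount_window_le_three_log
  set k : ℝ → ℝ := fun y ↦ if y ≤ u₀ then 1 / (1 + (u₀ - y + d) ^ 2) else 0 with hk
  have hk0 : ∀ y, 0 ≤ k y := fun y ↦ by
    simp only [hk]; split_ifs <;> positivity
  set B := (zetaZeroBox_finite 0 u₀).toFinset with hB
  have hFB : F ⊆ B := fun ρ hρ ↦ by
    rw [hB, Set.Finite.mem_toFinset]
    exact BCF.mem_zetaZeroBox_of_ntz (hF ρ hρ).1 (hF ρ hρ).2.1 (hF ρ hρ).2.2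
  have hm0 : ∀ ρ ∈ B, (0 : ℝ) ≤ riemannZetaZeroOrder ρ := by
    intro ρ hρ
    rw [hB, Set.Finite.mem_toFinset] at hρ
    exact_mod_cast ((riemannZetaZeroOrder_pos_iff (ne_one_of_riemannZeta_eq_zero hρ.1)).2 hρ.1).le
  -- `Σ_F m k = Σ_F m/(…)` and `≤ Σ_B m k`
  have h1 : ∑ ρ ∈ F, (riemannZetaZeroOrder ρ : ℝ) / (1 + (u₀ - ρ.im + d) ^ 2) =
      ∑ ρ ∈ F, (riemannZetaZeroOrder ρ : ℝ) * k ρ.im := by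
    refine Finset.sum_congr rfl fun ρ hρ ↦ ?_
    simp only [hk, if_pos (hF ρ hρ).2.2]
    ring
  have h2 : ∑ ρ ∈ F, (riemannZetaZeroOrder ρ : ℝ) * k ρ.im ≤
      ∑ ρ ∈ B, (riemannZetaZeroOrder ρ : ℝ) * k ρ.im :=
    Finset.sum_le_sum_of_subset_of_nonneg hFB fun ρ hρ _ ↦ mul_nonneg (hm0 ρ hρ) (hk0 _)
  -- dictionary
  have hdict := OrdinateDictionary.sum_zetaZeroBox_mul_eq_sum_range (fun y ↦ ((k y : ℝ) : ℂ)) u₀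
  have h3 : ∑ ρ ∈ B, (riemannZetaZeroOrder ρ : ℝ) * k ρ.im =
      ∑ n ∈ Finset.range (zetaZeroCount u₀), k (zetaOrdinate n) := by
    have : ((∑ ρ ∈ B, (riemannZetaZeroOrder ρ : ℝ) * k ρ.im : ℝ) : ℂ) =
        ((∑ n ∈ Finset.range (zetaZeroCount u₀), k (zetaOrdinate n) : ℝ) : ℂ) := by
      push_cast
      exact hdict
    exact_mod_cast this
  -- the enumeration sum: only `γ_n ≤ u₀` contribute, and `sum_below_le` bounds them
  set R := Finset.range (zetaZeroCount u₀) with hR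
  have h4 : ∑ n ∈ R, k (zetaOrdinate n) =
      ∑ n ∈ R.filter (fun n ↦ zetaOrdinate n ≤ u₀), 1 / (1 + (u₀ - zetaOrdinate n + d) ^ 2) := by
    rw [Finset.sum_filter]
  have h5 := Montgomery.sum_below_le (C₀ := 3) (by norm_num) hW (R.filter fun n ↦ zetaOrdinate n ≤ u₀)
    hu₀ hd (fun n hn ↦ (Finset.mem_filter.1 hn).2)
  calc ∑ ρ ∈ F, (riemannZetaZeroOrder ρ : ℝ) / (1 + (u₀ - ρ.im + d) ^ 2)
      = ∑ ρ ∈ F, (riemannZetaZeroOrder ρ : ℝ) * k ρ.im := h1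
    _ ≤ ∑ ρ ∈ B, (riemannZetaZeroOrder ρ : ℝ) * k ρ.im := h2
    _ = ∑ n ∈ R, k (zetaOrdinate n) := h3
    _ = _ := h4
    _ ≤ 8 * 3 * Real.log (u₀ + 2) / (d + 1) := h5
    _ = 24 * Real.log (u₀ + 2) / (d + 1) := by ring

/-- **Zeros above a point, with multiplicity**: for `0 ≤ u₀`, `0 ≤ d` and any finite set `F` of
distinct non-trivial zeros with `u₀ < Im ρ`,
`Σ_{ρ∈F} m(ρ)/(1 + (Im ρ − u₀ + d)²) ≤ 3(4 log(u₀+2) + 12 log(d+2))/(d+1)`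
(`Montgomery.sum_above_le`, `C₀ = 3`). [cite: AlpogeFurman2026, Proposition 4.3 (proof), p. 7] -/
theorem sum_order_div_kernel_above_le {u₀ d : ℝ} (hu₀ : 0 ≤ u₀) (hd : 0 ≤ d) (F : Finset ℂ)
    (hF : ∀ ρ ∈ F, ρ ∈ ZetaZeros.riemannZetaNontrivialZeros ∧ u₀ < ρ.im) :
    ∑ ρ ∈ F, (riemannZetaZeroOrder ρ : ℝ) / (1 + (ρ.im - u₀ + d) ^ 2) ≤
      3 * (4 * Real.log (u₀ + 2) + 12 * Real.log (d + 2)) / (d + 1) := by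
  classical
  have hW := zetaZeroCount_window_le_three_log
  set k : ℝ → ℝ := fun y ↦ if u₀ < y then 1 / (1 + (y - u₀ + d) ^ 2) else 0 with hk
  have hk0 : ∀ y, 0 ≤ k y := fun y ↦ by
    simp only [hk]; split_ifs <;> positivity
  -- a box containing `F`
  set Tm : ℝ := ∑ ρ ∈ F, ρ.im with hTm
  have hpos : ∀ ρ ∈ F, 0 < ρ.im := fun ρ hρ ↦ hu₀.trans_lt (hF ρ hρ).2
  have hTmρ : ∀ ρ ∈ F, ρ.im ≤ Tm := fun ρ hρ ↦
    Finset.single_le_sum (f := fun ρ : ℂ ↦ ρ.im) (fun σ hσ ↦ (hpos σ hσ).le) hρ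
  set B := (zetaZeroBox_finite 0 Tm).toFinset with hB
  have hFB : F ⊆ B := fun ρ hρ ↦ by
    rw [hB, Set.Finite.mem_toFinset]
    exact BCF.mem_zetaZeroBox_of_ntz (hF ρ hρ).1 (hpos ρ hρ) (hTmρ ρ hρ)
  have hm0 : ∀ ρ ∈ B, (0 : ℝ) ≤ riemannZetaZeroOrder ρ := by
    intro ρ hρ
    rw [hB, Set.Finite.mem_toFinset] at hρ
    exact_mod_cast ((riemannZetaZeroOrder_pos_iff (ne_one_of_riemannZeta_eq_zero hρ.1)).2 hρ.1).le
  have h1 : ∑ ρ ∈ F, (riemannZetaZeroOrder ρ : ℝ) / (1 + (ρ.im - u₀ + d) ^ 2) =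
      ∑ ρ ∈ F, (riemannZetaZeroOrder ρ : ℝ) * k ρ.im := by
    refine Finset.sum_congr rfl fun ρ hρ ↦ ?_
    simp only [hk, if_pos (hF ρ hρ).2]
    ring
  have h2 : ∑ ρ ∈ F, (riemannZetaZeroOrder ρ : ℝ) * k ρ.im ≤
      ∑ ρ ∈ B, (riemannZetaZeroOrder ρ : ℝ) * k ρ.im :=
    Finset.sum_le_sum_of_subset_of_nonneg hFB fun ρ hρ _ ↦ mul_nonneg (hm0 ρ hρ) (hk0 _)
  have hdict := OrdinateDictionary.sum_zetaZeroBox_mul_eq_sum_range (fun y ↦ ((k y : ℝ) : ℂ)) Tm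
  have h3 : ∑ ρ ∈ B, (riemannZetaZeroOrder ρ : ℝ) * k ρ.im =
      ∑ n ∈ Finset.range (zetaZeroCount Tm), k (zetaOrdinate n) := by
    have : ((∑ ρ ∈ B, (riemannZetaZeroOrder ρ : ℝ) * k ρ.im : ℝ) : ℂ) =
        ((∑ n ∈ Finset.range (zetaZeroCount Tm), k (zetaOrdinate n) : ℝ) : ℂ) := by
      push_cast
      exact hdict
    exact_mod_cast this
  set R := Finset.range (zetaZeroCount Tm) with hR
  have h4 : ∑ n ∈ R, k (zetaOrdinate n) =
      ∑ n ∈ R.filter (fun n ↦ u₀ < zetaOrdinate n), 1 / (1 + (zetaOrdinate n - u₀ + d) ^ 2) := by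
    rw [Finset.sum_filter]
  have h5 := Montgomery.sum_above_le (C₀ := 3) (by norm_num) hW (R.filter fun n ↦ u₀ < zetaOrdinate n)
    hu₀ hd (fun n hn ↦ (Finset.mem_filter.1 hn).2)
  calc ∑ ρ ∈ F, (riemannZetaZeroOrder ρ : ℝ) / (1 + (ρ.im - u₀ + d) ^ 2)
      = ∑ ρ ∈ F, (riemannZetaZeroOrder ρ : ℝ) * k ρ.im := h1
    _ ≤ ∑ ρ ∈ B, (riemannZetaZeroOrder ρ : ℝ) * k ρ.im := h2
    _ = ∑ n ∈ R, k (zetaOrdinate n) := h3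
    _ = _ := h4
    _ ≤ 3 * (4 * Real.log (u₀ + 2) + 12 * Real.log (d + 2)) / (d + 1) := h5

/-- **Zeros with negative ordinate, with multiplicity** (by conjugation, `m(ρ̄) = m(ρ)`): for `T ≥ 0`
and any finite set `F` of distinct non-trivial zeros with `Im ρ < 0`,
`Σ_{ρ∈F} m(ρ)/(1 + (T − Im ρ)²) ≤ 3(4 log 2 + 12 log(T+2))/(T+1)`.
[cite: AlpogeFurman2026, Proposition 4.3 (proof), p. 7] -/
theorem sum_order_div_kernel_neg_le {T : ℝ} (hT : 0 ≤ T) (F : Finset ℂ)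
    (hF : ∀ ρ ∈ F, ρ ∈ ZetaZeros.riemannZetaNontrivialZeros ∧ ρ.im < 0) :
    ∑ ρ ∈ F, (riemannZetaZeroOrder ρ : ℝ) / (1 + (T - ρ.im) ^ 2) ≤
      3 * (4 * Real.log (0 + 2) + 12 * Real.log (T + 2)) / (T + 1) := by
  classical
  have hinj : Set.InjOn (fun ρ : ℂ ↦ conj ρ) F := fun a _ b _ h ↦ by simpa using congrArg conj h
  have e1 : ∑ ρ ∈ F, (riemannZetaZeroOrder ρ : ℝ) / (1 + (T - ρ.im) ^ 2) =
      ∑ ρ ∈ F, (riemannZetaZeroOrder (conj ρ) : ℝ) / (1 + ((conj ρ).im - 0 + T) ^ 2) :=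
    Finset.sum_congr rfl fun ρ _ ↦ by
      rw [riemannZetaZeroOrder_conj_holds ρ, Complex.conj_im]; ring
  have e2 : ∑ ρ ∈ F, (riemannZetaZeroOrder (conj ρ) : ℝ) / (1 + ((conj ρ).im - 0 + T) ^ 2) =
      ∑ z ∈ F.image (fun ρ : ℂ ↦ conj ρ), (riemannZetaZeroOrder z : ℝ) / (1 + (z.im - 0 + T) ^ 2) :=
    (Finset.sum_image (f := fun z : ℂ ↦ (riemannZetaZeroOrder z : ℝ) / (1 + (z.im - 0 + T) ^ 2))
      fun a ha b hb h ↦ hinj ha hb h).symm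
  rw [e1, e2]
  refine sum_order_div_kernel_above_le le_rfl hT _ fun z hz ↦ ?_
  rw [Finset.mem_image] at hz
  obtain ⟨ρ, hρ, rfl⟩ := hz
  exact ⟨ZetaZeros.riemannZetaNontrivialZeros.conj_mem (hF ρ hρ).1, by simpa using (hF ρ hρ).2⟩


/-! ## §2. Per-zero Gabor mass far from the window, from the second-order decay -/

variable {ψ : ℝ → ℝ}

/-- `z − α_k = (Re z − α_k) + i Im z`. [folklore] -/
private theorem sub_grid_eq' (z : ℂ) (T L : ℝ) (k : ℤ) :
    z - (grid T L k : ℂ) = ((z.re - grid T L k : ℝ) : ℂ) + (z.im : ℂ) * I := by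
  apply Complex.ext <;> simp

/-- `α_k = T + k h`, `h = 2π/L`. [folklore] -/
private theorem grid_eq_add_mul (T L : ℝ) (k : ℤ) : grid T L k = T + (k : ℝ) * (2 * π / L) := by
  rw [grid]; ring

/-- `d h ≤ T` for `d = ⌊LT/2π⌋₊` (`T > 0`, `L > 0`). [folklore] -/
private theorem gridDim_mul_step_le {T : ℝ} (hT : 0 < T) (hL : 0 < logHeight T) :
    (gridDim T : ℝ) * (2 * π / logHeight T) ≤ T := by
  have hπ := Real.pi_pos
  have hx : 0 ≤ logHeight T * T / (2 * π) := by positivity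
  have h1 : (gridDim T : ℝ) ≤ logHeight T * T / (2 * π) := Nat.floor_le hx
  calc (gridDim T : ℝ) * (2 * π / logHeight T) ≤ logHeight T * T / (2 * π) * (2 * π / logHeight T) :=
        mul_le_mul_of_nonneg_right h1 (by positivity)
    _ = T := by field_simp

/-- The squared second-order bound at one grid frequency: if `|Re z − α_k| = D′ + n h` with
`D′ ≥ 1` then `|φ̂(z − α_k)|² ≤ (C² e^{L|Im z|}/D′²) · 1/(D′ + n h)²`.
[cite: AlpogeFurman2026, eq. (2.8) and Proposition 4.3 (proof), pp. 4, 7] -/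
theorem norm_sq_hat_phi_grid_le_inv_four {C : ℝ} (hC0 : 0 ≤ C) {T : ℝ}
    (hC : ∀ (ξ y : ℝ), (ξ ≠ 0 ∨ y ≠ 0) →
      ‖hat (fun u ↦ (phi ψ T u : ℂ)) ((ξ : ℂ) + (y : ℂ) * I)‖ ≤
        C * Real.exp (logHeight T * |y| / 2) / (ξ ^ 2 + y ^ 2))
    {z : ℂ} {k : ℤ} {D' : ℝ} {n : ℕ} {h : ℝ} (hh : 0 ≤ h) (hD' : 1 ≤ D')
    (hξ : |z.re - grid T (logHeight T) k| = D' + n * h) :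
    ‖hat (fun u ↦ (phi ψ T u : ℂ)) (z - grid T (logHeight T) k)‖ ^ 2 ≤
      C ^ 2 * Real.exp (logHeight T * |z.im|) / D' ^ 2 * (1 / (D' + n * h) ^ 2) := by
  set ξ : ℝ := z.re - grid T (logHeight T) k with hξdef
  have hξpos : 1 ≤ |ξ| := by
    rw [hξ]; have : 0 ≤ (n : ℝ) * h := by positivity
    linarith
  have hξ0 : ξ ≠ 0 := fun h0 ↦ by rw [h0, abs_zero] at hξpos; linarith
  have h1 := hC ξ z.im (Or.inl hξ0)
  rw [← sub_grid_eq'] at h1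
  have hξ2 : (D' + n * h) ^ 2 ≤ ξ ^ 2 + z.im ^ 2 := by
    rw [← hξ, sq_abs]; nlinarith [sq_nonneg z.im]
  have hE0 : 0 ≤ C * Real.exp (logHeight T * |z.im| / 2) := by positivity
  have hn0 : 0 ≤ (n : ℝ) * h := by positivity
  have hDn : 0 < D' + n * h := by linarith
  have h2 : ‖hat (fun u ↦ (phi ψ T u : ℂ)) (z - grid T (logHeight T) k)‖ ≤
      C * Real.exp (logHeight T * |z.im| / 2) / (D' + n * h) ^ 2 :=
    h1.trans (div_le_div_of_nonneg_left hE0 (by positivity) hξ2)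
  have h0 : 0 ≤ ‖hat (fun u ↦ (phi ψ T u : ℂ)) (z - grid T (logHeight T) k)‖ := norm_nonneg _
  have h3 := mul_self_le_mul_self h0 h2
  rw [← pow_two] at h3
  refine h3.trans ?_
  have e2 : Real.exp (logHeight T * |z.im|) =
      Real.exp (logHeight T * |z.im| / 2) * Real.exp (logHeight T * |z.im| / 2) := by
    rw [← Real.exp_add]; ring_nf
  rw [e2]
  -- `(C e/(D′+nh)²)² = C² e² /(D′+nh)⁴ ≤ C² e²/D′² · 1/(D′+nh)²`
  have hDn1 : D' ≤ D' + n * h := by linarith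
  have hkey : 1 / (D' + n * h) ^ 2 ≤ 1 / D' ^ 2 :=
    one_div_le_one_div_of_le (by positivity) (pow_le_pow_left₀ (by linarith) hDn1 2)
  set E := Real.exp (logHeight T * |z.im| / 2) with hE
  have eq1 : C * E / (D' + ↑n * h) ^ 2 * (C * E / (D' + ↑n * h) ^ 2) =
      C ^ 2 * (E * E) * (1 / (D' + n * h) ^ 2) * (1 / (D' + n * h) ^ 2) := by ring
  have eq2 : C ^ 2 * (E * E) / D' ^ 2 * (1 / (D' + n * h) ^ 2) =
      C ^ 2 * (E * E) * (1 / D' ^ 2) * (1 / (D' + n * h) ^ 2) := by ring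
  rw [eq1, eq2]
  have hA : 0 ≤ C ^ 2 * (E * E) := by positivity
  exact mul_le_mul_of_nonneg_right (mul_le_mul_of_nonneg_left hkey hA) (by positivity)

/-- **Gabor mass of a zero far to the LEFT of the window** (`Re z + D ≤ T`, `D ≥ 1`, `|Im z| ≤ ½`):
`Σ_{0≤k<d} |φ̂(z − α_k)|² ≤ (C² e^{L|Im z|}/D²)(1/D² + L/(2πD))`.
[cite: AlpogeFurman2026, Proposition 4.3 (proof), p. 7] -/
theorem sum_norm_sq_hat_far_left {C : ℝ} (hC0 : 0 ≤ C) {T : ℝ} (hL : 10 ≤ logHeight T)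
    (hC : ∀ (ξ y : ℝ), (ξ ≠ 0 ∨ y ≠ 0) →
      ‖hat (fun u ↦ (phi ψ T u : ℂ)) ((ξ : ℂ) + (y : ℂ) * I)‖ ≤
        C * Real.exp (logHeight T * |y| / 2) / (ξ ^ 2 + y ^ 2))
    {z : ℂ} {D : ℝ} (hD : 1 ≤ D) (hx : z.re + D ≤ T) :
    ∑ k : Fin (gridDim T), ‖hat (fun u ↦ (phi ψ T u : ℂ)) (z - grid T (logHeight T) ((k : ℕ) : ℤ))‖ ^ 2 ≤
      C ^ 2 * Real.exp (logHeight T * |z.im|) / D ^ 2 *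
        (1 / D ^ 2 + 1 / (2 * π / logHeight T * D)) := by
  classical
  have hπ := Real.pi_gt_three
  have hL0 : 0 < logHeight T := by linarith
  set h := 2 * π / logHeight T with hhdef
  have hh0 : 0 < h := by positivity
  set W := C ^ 2 * Real.exp (logHeight T * |z.im|) with hW
  have hW0 : 0 ≤ W := by positivity
  set D' := T - z.re with hD'
  have hD'D : D ≤ D' := by linarith
  have hD'1 : 1 ≤ D' := hD.trans hD'D
  have hterm : ∀ k : Fin (gridDim T),
      ‖hat (fun u ↦ (phi ψ T u : ℂ)) (z - grid T (logHeight T) ((k : ℕ) : ℤ))‖ ^ 2 ≤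
        W / D' ^ 2 * (1 / (D' + ((k : ℕ) : ℝ) * h) ^ 2) := by
    intro k
    have hξ : |z.re - grid T (logHeight T) ((k : ℕ) : ℤ)| = D' + ((k : ℕ) : ℕ) * h := by
      rw [grid_eq_add_mul, abs_of_nonpos]
      · push_cast; rw [hD', hhdef]; ring
      · have : 0 ≤ ((k : ℕ) : ℝ) * (2 * π / logHeight T) := by positivity
        push_cast; linarith
    exact norm_sq_hat_phi_grid_le_inv_four hC0 hC hh0.le hD'1 hξ
  refine (Finset.sum_le_sum fun k _ ↦ hterm k).trans ?_
  have hsum : ∑ k : Fin (gridDim T), W / D' ^ 2 * (1 / (D' + ((k : ℕ) : ℝ) * h) ^ 2) =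
      W / D' ^ 2 * ∑ j ∈ Finset.range (gridDim T), 1 / (D' + (j : ℝ) * h) ^ 2 := by
    rw [Finset.mul_sum, Fin.sum_univ_eq_sum_range (fun j ↦ W / D' ^ 2 * (1 / (D' + (j : ℝ) * h) ^ 2))]
  rw [hsum]
  have hWD : W / D' ^ 2 ≤ W / D ^ 2 :=
    div_le_div_of_nonneg_left hW0 (by positivity) (pow_le_pow_left₀ (by linarith) hD'D 2)
  have hS := sum_inv_sq_arith_le (by linarith : 0 < D') hh0 (gridDim T)
  have h1 : 1 / D' ^ 2 ≤ 1 / D ^ 2 :=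
    one_div_le_one_div_of_le (by positivity) (pow_le_pow_left₀ (by linarith) hD'D 2)
  have h2 : 1 / (h * D') ≤ 1 / (h * D) :=
    one_div_le_one_div_of_le (by positivity) (mul_le_mul_of_nonneg_left hD'D hh0.le)
  have hS0 : 0 ≤ ∑ j ∈ Finset.range (gridDim T), 1 / (D' + (j : ℝ) * h) ^ 2 :=
    Finset.sum_nonneg fun j _ ↦ by positivity
  calc W / D' ^ 2 * ∑ j ∈ Finset.range (gridDim T), 1 / (D' + (j : ℝ) * h) ^ 2
      ≤ W / D ^ 2 * (1 / D ^ 2 + 1 / (h * D)) :=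
        mul_le_mul hWD (hS.trans (by linarith)) hS0 (by positivity)
    _ = _ := by rw [hhdef]

/-- **Gabor mass of a zero far to the RIGHT of the window** (`2T + D ≤ Re z`, `D ≥ 1`, `T > 0`).
[cite: AlpogeFurman2026, Proposition 4.3 (proof), p. 7] -/
theorem sum_norm_sq_hat_far_right {C : ℝ} (hC0 : 0 ≤ C) {T : ℝ} (hT : 0 < T) (hL : 10 ≤ logHeight T)
    (hC : ∀ (ξ y : ℝ), (ξ ≠ 0 ∨ y ≠ 0) →
      ‖hat (fun u ↦ (phi ψ T u : ℂ)) ((ξ : ℂ) + (y : ℂ) * I)‖ ≤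
        C * Real.exp (logHeight T * |y| / 2) / (ξ ^ 2 + y ^ 2))
    {z : ℂ} {D : ℝ} (hD : 1 ≤ D) (hx : 2 * T + D ≤ z.re) :
    ∑ k : Fin (gridDim T), ‖hat (fun u ↦ (phi ψ T u : ℂ)) (z - grid T (logHeight T) ((k : ℕ) : ℤ))‖ ^ 2 ≤
      C ^ 2 * Real.exp (logHeight T * |z.im|) / D ^ 2 *
        (1 / D ^ 2 + 1 / (2 * π / logHeight T * D)) := by
  classical
  have hπ := Real.pi_gt_three
  have hL0 : 0 < logHeight T := by linarith
  set h := 2 * π / logHeight T with hhdef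
  have hh0 : 0 < h := by positivity
  have hh1 : h ≤ 1 := by rw [hhdef, div_le_one hL0]; linarith [Real.pi_lt_d4]
  have hd1 : (gridDim T : ℝ) * h ≤ T := gridDim_mul_step_le hT hL0
  set d := gridDim T with hddef
  set W := C ^ 2 * Real.exp (logHeight T * |z.im|) with hW
  have hW0 : 0 ≤ W := by positivity
  -- `D′ = x − T − (d − 1)h ≥ x − 2T + h ≥ D`
  set D' := z.re - T - ((d : ℝ) - 1) * h with hD'
  have hD'D : D ≤ D' := by
    have : ((d : ℝ) - 1) * h ≤ T - h := by nlinarith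
    linarith
  have hD'1 : 1 ≤ D' := hD.trans hD'D
  have hterm : ∀ k : Fin d,
      ‖hat (fun u ↦ (phi ψ T u : ℂ)) (z - grid T (logHeight T) ((k : ℕ) : ℤ))‖ ^ 2 ≤
        W / D' ^ 2 * (1 / (D' + ((d - 1 - (k : ℕ) : ℕ) : ℝ) * h) ^ 2) := by
    intro k
    have hk : (k : ℕ) ≤ d - 1 := Nat.le_sub_one_of_lt k.2
    have hd0 : 1 ≤ d := Nat.one_le_of_lt k.2
    have hcast : ((d - 1 - (k : ℕ) : ℕ) : ℝ) = (d : ℝ) - 1 - (k : ℕ) := by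
      rw [Nat.cast_sub hk, Nat.cast_sub hd0]; push_cast; ring
    have hξ : |z.re - grid T (logHeight T) ((k : ℕ) : ℤ)| = D' + ((d - 1 - (k : ℕ) : ℕ) : ℕ) * h := by
      rw [grid_eq_add_mul, abs_of_nonneg]
      · push_cast
        rw [hcast, hD', hhdef]; ring
      · have : ((k : ℕ) : ℝ) * h ≤ ((d : ℝ) - 1) * h := by
          refine mul_le_mul_of_nonneg_right ?_ hh0.le
          have : ((k : ℕ) : ℝ) ≤ ((d - 1 : ℕ) : ℝ) := by exact_mod_cast hk
          rw [Nat.cast_sub hd0] at this; push_cast at this; exact this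
        push_cast
        have e : ((k : ℕ) : ℝ) * (2 * π / logHeight T) = ((k : ℕ) : ℝ) * h := by rw [hhdef]
        rw [e]
        linarith
    exact norm_sq_hat_phi_grid_le_inv_four hC0 hC hh0.le hD'1 hξ
  refine (Finset.sum_le_sum fun k _ ↦ hterm k).trans ?_
  have hsum : ∑ k : Fin d, W / D' ^ 2 * (1 / (D' + ((d - 1 - (k : ℕ) : ℕ) : ℝ) * h) ^ 2) =
      W / D' ^ 2 * ∑ j ∈ Finset.range d, 1 / (D' + (j : ℝ) * h) ^ 2 := by
    rw [Finset.mul_sum, Fin.sum_univ_eq_sum_range (fun j ↦ W / D' ^ 2 * (1 / (D' + ((d - 1 - j : ℕ) : ℝ) * h) ^ 2)),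
      ← Finset.sum_range_reflect (fun j ↦ W / D' ^ 2 * (1 / (D' + (j : ℝ) * h) ^ 2)) d]
  rw [hsum]
  have hWD : W / D' ^ 2 ≤ W / D ^ 2 :=
    div_le_div_of_nonneg_left hW0 (by positivity) (pow_le_pow_left₀ (by linarith) hD'D 2)
  have hS := sum_inv_sq_arith_le (by linarith : 0 < D') hh0 d
  have h1 : 1 / D' ^ 2 ≤ 1 / D ^ 2 :=
    one_div_le_one_div_of_le (by positivity) (pow_le_pow_left₀ (by linarith) hD'D 2)
  have h2 : 1 / (h * D') ≤ 1 / (h * D) :=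
    one_div_le_one_div_of_le (by positivity) (mul_le_mul_of_nonneg_left hD'D hh0.le)
  have hS0 : 0 ≤ ∑ j ∈ Finset.range d, 1 / (D' + (j : ℝ) * h) ^ 2 :=
    Finset.sum_nonneg fun j _ ↦ by positivity
  calc W / D' ^ 2 * ∑ j ∈ Finset.range d, 1 / (D' + (j : ℝ) * h) ^ 2
      ≤ W / D ^ 2 * (1 / D ^ 2 + 1 / (h * D)) :=
        mul_le_mul hWD (hS.trans (by linarith)) hS0 (by positivity)
    _ = _ := by rw [hhdef]


/-! ## §3. Proposition 4.3 (tail) in partial-sum form -/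

/-- Numerics at height `T ≥ 300` with `L ≥ 10`: `s = √T` satisfies `17 ≤ s`, `s² = T`,
`e^{L/2} ≤ s`, and `log(3T + 3) ≤ 2L`. [folklore] -/
private theorem height_numerics {T : ℝ} (hT : 300 ≤ T) (hL : 10 ≤ logHeight T) :
    17 ≤ Real.sqrt T ∧ Real.sqrt T * Real.sqrt T = T ∧ Real.exp (logHeight T / 2) ≤ Real.sqrt T ∧
      Real.log (3 * T + 3) ≤ 2 * logHeight T := by
  have hπ := Real.pi_gt_three
  have hπ4 := Real.pi_lt_d4
  have hT0 : 0 < T := by linarith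
  have hs17 : 17 ≤ Real.sqrt T := by
    rw [show (17 : ℝ) = Real.sqrt (17 ^ 2) by rw [Real.sqrt_sq (by norm_num)]]
    exact Real.sqrt_le_sqrt (by nlinarith)
  have hsq : Real.sqrt T * Real.sqrt T = T := Real.mul_self_sqrt hT0.le
  refine ⟨hs17, hsq, ?_, ?_⟩
  · -- `e^{L/2} = √(T/2π) ≤ √T`
    have hexpL : Real.exp (logHeight T) = T / (2 * π) := by
      rw [logHeight, Real.exp_log (by positivity)]
    have h1 : Real.exp (logHeight T / 2) = Real.sqrt (T / (2 * π)) := by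
      rw [Real.exp_half, hexpL]
    rw [h1]
    exact Real.sqrt_le_sqrt (div_le_self hT0.le (by linarith))
  · -- `log(3T+3) ≤ log(4T) = log 4 + log 2π + L ≤ 2L`
    have h1 : Real.log (3 * T + 3) ≤ Real.log (4 * T) := Real.log_le_log (by linarith) (by linarith)
    have h2 : Real.log (4 * T) = Real.log 4 + Real.log (2 * π) + logHeight T := by
      rw [logHeight, Real.log_mul (by norm_num) hT0.ne', Real.log_div hT0.ne' (by positivity)]
      ring
    have h4 : Real.log 4 ≤ 2 := by
      rw [show (4 : ℝ) = 2 ^ 2 by norm_num, Real.log_pow]; have := Real.log_two_lt_d9; push_cast; linarith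
    have h2π : Real.log (2 * π) ≤ 2 := by
      rw [Real.log_le_iff_le_exp (by positivity)]
      have h := Real.exp_one_gt_d9
      have e : Real.exp 2 = Real.exp 1 * Real.exp 1 := by rw [← Real.exp_add]; norm_num
      nlinarith
    linarith

/-- A far zero is either below `T − √T` or at least `2T + √T`. [cite: AlpogeFurman2026, §2.3 (p. 4)] -/
private theorem far_cases {T : ℝ} {ρ : ℂ} (hρ : ρ ∈ ZetaZeros.riemannZetaNontrivialZeros)
    (hfar : ρ ∉ nearZeros T) : ρ.im < T - Real.sqrt T ∨ 2 * T + Real.sqrt T ≤ ρ.im := by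
  by_contra h
  rw [not_or, not_lt, not_le] at h
  obtain ⟨h0, h1, h2⟩ := ZetaZeros.riemannZetaNontrivialZeros.mem_iff'.1 hρ
  exact hfar ⟨h0, h1.le, h2.le, h.1, h.2⟩

/-- Per-zero tail bound, zero BELOW the window: `Σ_k |φ̂(γ_ρ − α_k)|² ≤ 2C²L/(1 + (T − γ)²)`.
[cite: AlpogeFurman2026, Proposition 4.3 (proof), p. 7] -/
private theorem perZero_below {C : ℝ} (hC0 : 0 ≤ C) {T : ℝ} (hT : 300 ≤ T)
    (hL : 10 ≤ logHeight T)
    (hC : ∀ (ξ y : ℝ), (ξ ≠ 0 ∨ y ≠ 0) →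
      ‖hat (fun u ↦ (phi ψ T u : ℂ)) ((ξ : ℂ) + (y : ℂ) * I)‖ ≤
        C * Real.exp (logHeight T * |y| / 2) / (ξ ^ 2 + y ^ 2))
    {ρ : ℂ} (hρ : ρ ∈ ZetaZeros.riemannZetaNontrivialZeros) (hbelow : ρ.im < T - Real.sqrt T) :
    ∑ k : Fin (gridDim T), ‖hat (fun u ↦ (phi ψ T u : ℂ)) (gammaOf ρ - grid T (logHeight T) ((k : ℕ) : ℤ))‖ ^ 2 ≤
      2 * C ^ 2 * logHeight T / (1 + (T - ρ.im) ^ 2) := by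
  have hπ := Real.pi_gt_three
  obtain ⟨hs17, hsq, hexp, -⟩ := height_numerics hT hL
  set s := Real.sqrt T with hs
  set L := logHeight T with hLdef
  have hL0 : 0 < L := by linarith
  obtain ⟨hγ, hy⟩ := gammaOf_eq_of_mem hρ
  have hzre : (gammaOf ρ).re = ρ.im := (gammaOf_re_im ρ).1
  have hzim : (gammaOf ρ).im = 1 / 2 - ρ.re := (gammaOf_re_im ρ).2
  set D := T - ρ.im with hD
  have hDs : s ≤ D := by linarith
  have hD1 : 1 ≤ D := by linarith
  have h := sum_norm_sq_hat_far_left (ψ := ψ) hC0 hL hC (z := gammaOf ρ) hD1 (by rw [hzre]; linarith)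
  rw [← hLdef, hzim] at h
  refine h.trans ?_
  -- `e^{L|y|} ≤ e^{L/2} ≤ s`
  have he : Real.exp (L * |1 / 2 - ρ.re|) ≤ s := by
    refine (Real.exp_le_exp.2 ?_).trans hexp
    nlinarith [abs_nonneg (1 / 2 - ρ.re)]
  -- `1/D² + L/(2πD) ≤ L/s`
  have hbr : 1 / D ^ 2 + 1 / (2 * π / L * D) ≤ L / s := by
    rw [show 1 / (2 * π / L * D) = L / (2 * π * D) by field_simp]
    have h1 : 1 / D ^ 2 ≤ 1 / (s * D) :=
      one_div_le_one_div_of_le (by positivity) (by rw [sq]; exact mul_le_mul_of_nonneg_right hDs (by linarith))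
    have h2 : L / (2 * π * D) ≤ L / (2 * π * s) :=
      div_le_div_of_nonneg_left hL0.le (by positivity) (by nlinarith)
    have h3 : 1 / (s * D) ≤ 1 / (s * s) :=
      one_div_le_one_div_of_le (by positivity) (mul_le_mul_of_nonneg_left hDs (by linarith))
    have h4 : 1 / (s * s) + L / (2 * π * s) ≤ L / s := by
      have hs0 : 0 < s := by linarith
      have hLs : 170 ≤ L * s := by nlinarith
      have key : 2 * π ≤ L * s * (2 * π - 1) := by nlinarith
      rw [div_add_div _ _ (by positivity) (by positivity), div_le_div_iff₀ (by positivity) (by positivity)]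
      have := mul_le_mul_of_nonneg_right key (mul_nonneg hs0.le hs0.le)
      nlinarith
    linarith
  -- `1/D² ≤ 2/(1+D²)`
  have hD2 : 1 / D ^ 2 ≤ 2 / (1 + D ^ 2) := by
    rw [div_le_div_iff₀ (by positivity) (by positivity)]; nlinarith
  calc C ^ 2 * Real.exp (L * |1 / 2 - ρ.re|) / D ^ 2 * (1 / D ^ 2 + 1 / (2 * π / L * D))
      = C ^ 2 * Real.exp (L * |1 / 2 - ρ.re|) * (1 / D ^ 2) * (1 / D ^ 2 + 1 / (2 * π / L * D)) := by ring
    _ ≤ C ^ 2 * s * (2 / (1 + D ^ 2)) * (L / s) := by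
        gcongr
    _ = 2 * C ^ 2 * L / (1 + D ^ 2) := by field_simp

/-- Per-zero tail bound, zero ABOVE the window: `Σ_k |φ̂(γ_ρ − α_k)|² ≤ 2C²L/(1 + (γ − 2T)²)`.
[cite: AlpogeFurman2026, Proposition 4.3 (proof), p. 7] -/
private theorem perZero_above {C : ℝ} (hC0 : 0 ≤ C) {T : ℝ} (hT : 300 ≤ T)
    (hL : 10 ≤ logHeight T)
    (hC : ∀ (ξ y : ℝ), (ξ ≠ 0 ∨ y ≠ 0) →
      ‖hat (fun u ↦ (phi ψ T u : ℂ)) ((ξ : ℂ) + (y : ℂ) * I)‖ ≤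
        C * Real.exp (logHeight T * |y| / 2) / (ξ ^ 2 + y ^ 2))
    {ρ : ℂ} (hρ : ρ ∈ ZetaZeros.riemannZetaNontrivialZeros) (habove : 2 * T + Real.sqrt T ≤ ρ.im) :
    ∑ k : Fin (gridDim T), ‖hat (fun u ↦ (phi ψ T u : ℂ)) (gammaOf ρ - grid T (logHeight T) ((k : ℕ) : ℤ))‖ ^ 2 ≤
      2 * C ^ 2 * logHeight T / (1 + (ρ.im - 2 * T) ^ 2) := by
  have hπ := Real.pi_gt_three
  obtain ⟨hs17, hsq, hexp, -⟩ := height_numerics hT hL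
  set s := Real.sqrt T with hs
  set L := logHeight T with hLdef
  have hL0 : 0 < L := by linarith
  have hT0 : 0 < T := by linarith
  obtain ⟨hγ, hy⟩ := gammaOf_eq_of_mem hρ
  have hzre : (gammaOf ρ).re = ρ.im := (gammaOf_re_im ρ).1
  have hzim : (gammaOf ρ).im = 1 / 2 - ρ.re := (gammaOf_re_im ρ).2
  set D := ρ.im - 2 * T with hD
  have hDs : s ≤ D := by linarith
  have hD1 : 1 ≤ D := by linarith
  have h := sum_norm_sq_hat_far_right (ψ := ψ) hC0 hT0 hL hC (z := gammaOf ρ) hD1 (by rw [hzre]; linarith)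
  rw [← hLdef, hzim] at h
  refine h.trans ?_
  have he : Real.exp (L * |1 / 2 - ρ.re|) ≤ s := by
    refine (Real.exp_le_exp.2 ?_).trans hexp
    nlinarith [abs_nonneg (1 / 2 - ρ.re)]
  have hbr : 1 / D ^ 2 + 1 / (2 * π / L * D) ≤ L / s := by
    rw [show 1 / (2 * π / L * D) = L / (2 * π * D) by field_simp]
    have h1 : 1 / D ^ 2 ≤ 1 / (s * D) :=
      one_div_le_one_div_of_le (by positivity) (by rw [sq]; exact mul_le_mul_of_nonneg_right hDs (by linarith))
    have h2 : L / (2 * π * D) ≤ L / (2 * π * s) :=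
      div_le_div_of_nonneg_left hL0.le (by positivity) (by nlinarith)
    have h3 : 1 / (s * D) ≤ 1 / (s * s) :=
      one_div_le_one_div_of_le (by positivity) (mul_le_mul_of_nonneg_left hDs (by linarith))
    have h4 : 1 / (s * s) + L / (2 * π * s) ≤ L / s := by
      have hs0 : 0 < s := by linarith
      have hLs : 170 ≤ L * s := by nlinarith
      have key : 2 * π ≤ L * s * (2 * π - 1) := by nlinarith
      rw [div_add_div _ _ (by positivity) (by positivity), div_le_div_iff₀ (by positivity) (by positivity)]
      have := mul_le_mul_of_nonneg_right key (mul_nonneg hs0.le hs0.le)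
      nlinarith
    linarith
  have hD2 : 1 / D ^ 2 ≤ 2 / (1 + D ^ 2) := by
    rw [div_le_div_iff₀ (by positivity) (by positivity)]; nlinarith
  calc C ^ 2 * Real.exp (L * |1 / 2 - ρ.re|) / D ^ 2 * (1 / D ^ 2 + 1 / (2 * π / L * D))
      = C ^ 2 * Real.exp (L * |1 / 2 - ρ.re|) * (1 / D ^ 2) * (1 / D ^ 2 + 1 / (2 * π / L * D)) := by ring
    _ ≤ C ^ 2 * s * (2 / (1 + D ^ 2)) * (L / s) := by
        gcongr
    _ = 2 * C ^ 2 * L / (1 + D ^ 2) := by field_simp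

end AlpogeFurman2026

open AlpogeFurman2026 in
/-- **[AF26] Proposition 4.3 (Tail), partial-sum form for the typed model.** For a window `ψ` there
is `C` such that for every `T ≥ 300` with `L = log(T/2π) ≥ 10` and every finite set `F` of distinct
non-trivial zeros NOT seen by the window (`ρ ∉ nearZeros T`, i.e. `Im ρ < T − √T` or
`Im ρ ≥ 2T + √T`), the Gabor mass they carry is
`Σ_{ρ∈F} m_ρ Σ_{0≤k<d} |φ̂(γ_ρ − α_k)|² ≤ C L²/√T`. Dividing by `aL² ≍ L²` this is the printed
`‖Ẽ‖₁ ≤ (aL²)⁻¹ Σ_{Re γ_ρ ∉ I′} m_ρ ‖v_ρ‖₂² ≪ T^{−1/2}` (every finite truncation of the sum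
defining `Ẽ`). Route as printed: `‖v_ρ‖₂² ≤ Σ_k C² e^{L|Im γ_ρ|}/|Re γ_ρ − α_k|⁴ ≪ √X L D_ρ⁻³`
(`D_ρ = dist(Re γ_ρ, I) ≥ √T`, second-order decay of `CriticalLineTwoThirdsWindowDecay`), then the
zero density `N(t, t+1) ≪ log(|t|+3)` — here through the shifted Cauchy-kernel sums with
multiplicity of §1. [cite: AlpogeFurman2026, Proposition 4.3 (p. 7)] -/
theorem AlpogeFurman2026_tail_partial_sum {ψ : ℝ → ℝ} (hψ : IsWindow ψ) :
    ∃ C : ℝ, 0 ≤ C ∧ ∀ T : ℝ, 300 ≤ T → 10 ≤ logHeight T →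
      ∀ F : Finset ℂ, (∀ ρ ∈ F, ρ ∈ ZetaZeros.riemannZetaNontrivialZeros ∧ ρ ∉ nearZeros T) →
        ∑ ρ ∈ F, (riemannZetaZeroOrder ρ : ℝ) *
            ∑ k : Fin (gridDim T), ‖hat (fun u ↦ (phi ψ T u : ℂ))
              (gammaOf ρ - grid T (logHeight T) ((k : ℕ) : ℤ))‖ ^ 2 ≤
          C * logHeight T ^ 2 / Real.sqrt T := by
  classical
  obtain ⟨C, hC0, hC⟩ := exists_norm_hat_phi_le_inv_sq' hψ
  refine ⟨480 * C ^ 2, by positivity, fun T hT hL F hF ↦ ?_⟩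
  have hπ := Real.pi_gt_three
  obtain ⟨hs17, hsq, -, hlog⟩ := height_numerics hT hL
  set s := Real.sqrt T with hs
  set L := logHeight T with hLdef
  have hL0 : 0 < L := by linarith
  have hT0 : 0 < T := by linarith
  have hsT : s ≤ T := by nlinarith
  have hCT := hC T (by linarith)
  -- weights are nonnegative
  have hm0 : ∀ ρ ∈ F, (0 : ℝ) ≤ riemannZetaZeroOrder ρ := fun ρ hρ ↦ by
    exact_mod_cast riemannZetaZeroOrder_nonneg (ZetaZeros.riemannZetaNontrivialZeros.ne_one (hF ρ hρ).1)
  -- per-zero bound by the kernel `κ ρ`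
  set κ : ℂ → ℝ := fun ρ ↦ if ρ.im < T - s then 1 / (1 + (T - ρ.im) ^ 2) else 1 / (1 + (ρ.im - 2 * T) ^ 2)
    with hκ
  have hper : ∀ ρ ∈ F, ∑ k : Fin (gridDim T), ‖hat (fun u ↦ (phi ψ T u : ℂ))
      (gammaOf ρ - grid T (logHeight T) ((k : ℕ) : ℤ))‖ ^ 2 ≤ 2 * C ^ 2 * L * κ ρ := by
    intro ρ hρ
    rcases far_cases (hF ρ hρ).1 (hF ρ hρ).2 with h | h
    · have h' : ρ.im < T - s := h
      have hk : κ ρ = 1 / (1 + (T - ρ.im) ^ 2) := by simp only [hκ]; rw [if_pos h']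
      rw [hk]
      have := perZero_below hC0 hT hL hCT (hF ρ hρ).1 h
      rw [← hLdef] at this
      calc _ ≤ 2 * C ^ 2 * L / (1 + (T - ρ.im) ^ 2) := this
        _ = 2 * C ^ 2 * L * (1 / (1 + (T - ρ.im) ^ 2)) := by ring
    · have h' : ¬ ρ.im < T - s := by
        have : 2 * T + s ≤ ρ.im := h
        intro hlt; linarith
      have hk : κ ρ = 1 / (1 + (ρ.im - 2 * T) ^ 2) := by simp only [hκ]; rw [if_neg h']
      rw [hk]
      have := perZero_above hC0 hT hL hCT (hF ρ hρ).1 h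
      rw [← hLdef] at this
      calc _ ≤ 2 * C ^ 2 * L / (1 + (ρ.im - 2 * T) ^ 2) := this
        _ = 2 * C ^ 2 * L * (1 / (1 + (ρ.im - 2 * T) ^ 2)) := by ring
  -- the three kernel sums
  set F₁ := F.filter (fun ρ : ℂ ↦ ρ.im < 0) with hF₁
  set F₂ := F.filter (fun ρ : ℂ ↦ 0 < ρ.im ∧ ρ.im < T - s) with hF₂
  set F₃ := F.filter (fun ρ : ℂ ↦ 2 * T + s ≤ ρ.im) with hF₃
  have hsplit : ∑ ρ ∈ F, (riemannZetaZeroOrder ρ : ℝ) * κ ρ =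
      ∑ ρ ∈ F₁, (riemannZetaZeroOrder ρ : ℝ) * κ ρ + ∑ ρ ∈ F₂, (riemannZetaZeroOrder ρ : ℝ) * κ ρ +
        ∑ ρ ∈ F₃, (riemannZetaZeroOrder ρ : ℝ) * κ ρ := by
    have hdisj12 : Disjoint F₁ F₂ := by
      rw [hF₁, hF₂, Finset.disjoint_filter]; intro ρ _ h1 h2; linarith [h2.1]
    have hdisj3 : Disjoint (F₁ ∪ F₂) F₃ := by
      rw [Finset.disjoint_left]; intro ρ h1 h3
      rw [Finset.mem_union, hF₁, hF₂, Finset.mem_filter, Finset.mem_filter] at h1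
      rw [hF₃, Finset.mem_filter] at h3
      rcases h1 with h1 | h1
      · linarith [h1.2, h3.2]
      · linarith [h1.2.2, h3.2]
    have hunion : F = F₁ ∪ F₂ ∪ F₃ := by
      ext ρ
      simp only [Finset.mem_union, hF₁, hF₂, hF₃, Finset.mem_filter]
      constructor
      · intro hρ
        have hne : ρ.im ≠ 0 := ZetaZeros.riemannZetaNontrivialZeros.im_ne_zero (hF ρ hρ).1
        rcases far_cases (hF ρ hρ).1 (hF ρ hρ).2 with h | h
        · rcases lt_or_gt_of_ne hne with hn | hp
          · exact Or.inl (Or.inl ⟨hρ, hn⟩)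
          · exact Or.inl (Or.inr ⟨hρ, hp, h⟩)
        · exact Or.inr ⟨hρ, h⟩
      · rintro ((⟨h, -⟩ | ⟨h, -⟩) | ⟨h, -⟩) <;> exact h
    rw [hunion, Finset.sum_union hdisj3, Finset.sum_union hdisj12]
  -- F₁: negative ordinates
  have hK₁ : ∑ ρ ∈ F₁, (riemannZetaZeroOrder ρ : ℝ) * κ ρ ≤ 48 * (2 * L) / s := by
    have e : ∑ ρ ∈ F₁, (riemannZetaZeroOrder ρ : ℝ) * κ ρ =
        ∑ ρ ∈ F₁, (riemannZetaZeroOrder ρ : ℝ) / (1 + (T - ρ.im) ^ 2) := by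
      refine Finset.sum_congr rfl fun ρ hρ ↦ ?_
      rw [hF₁, Finset.mem_filter] at hρ
      have : ρ.im < T - s := by linarith [hρ.2]
      have hk : κ ρ = 1 / (1 + (T - ρ.im) ^ 2) := by simp only [hκ]; rw [if_pos this]
      rw [hk]; ring
    rw [e]
    have h := sum_order_div_kernel_neg_le hT0.le F₁ fun ρ hρ ↦ by
      rw [hF₁, Finset.mem_filter] at hρ; exact ⟨(hF ρ hρ.1).1, hρ.2⟩
    refine h.trans ?_
    have hl2 : Real.log (0 + 2) ≤ Real.log (3 * T + 3) := Real.log_le_log (by norm_num) (by linarith)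
    have hlT : Real.log (T + 2) ≤ Real.log (3 * T + 3) := Real.log_le_log (by linarith) (by linarith)
    have hl0 : 0 ≤ Real.log (0 + 2) := Real.log_nonneg (by norm_num)
    rw [div_le_div_iff₀ (by positivity) (by positivity)]
    nlinarith
  -- F₂: positive ordinates below `T − s`
  have hK₂ : ∑ ρ ∈ F₂, (riemannZetaZeroOrder ρ : ℝ) * κ ρ ≤ 24 * (2 * L) / s := by
    have e : ∑ ρ ∈ F₂, (riemannZetaZeroOrder ρ : ℝ) * κ ρ =
        ∑ ρ ∈ F₂, (riemannZetaZeroOrder ρ : ℝ) / (1 + ((T - s) - ρ.im + s) ^ 2) := by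
      refine Finset.sum_congr rfl fun ρ hρ ↦ ?_
      rw [hF₂, Finset.mem_filter] at hρ
      have hk : κ ρ = 1 / (1 + (T - ρ.im) ^ 2) := by simp only [hκ]; rw [if_pos hρ.2.2]
      rw [hk]; ring
    rw [e]
    have h := sum_order_div_kernel_below_le (u₀ := T - s) (d := s) (by linarith) (by linarith) F₂
      fun ρ hρ ↦ by
        rw [hF₂, Finset.mem_filter] at hρ; exact ⟨(hF ρ hρ.1).1, hρ.2.1, hρ.2.2.le⟩
    refine h.trans ?_
    have hlT : Real.log (T - s + 2) ≤ Real.log (3 * T + 3) := Real.log_le_log (by linarith) (by linarith)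
    have hl0 : 0 ≤ Real.log (T - s + 2) := Real.log_nonneg (by linarith)
    rw [div_le_div_iff₀ (by positivity) (by positivity)]
    nlinarith
  -- F₃: ordinates above `2T + s`
  have hK₃ : ∑ ρ ∈ F₃, (riemannZetaZeroOrder ρ : ℝ) * κ ρ ≤ 48 * (2 * L) / s := by
    have e : ∑ ρ ∈ F₃, (riemannZetaZeroOrder ρ : ℝ) * κ ρ =
        ∑ ρ ∈ F₃, (riemannZetaZeroOrder ρ : ℝ) / (1 + (ρ.im - (2 * T + s - 1) + (s - 1)) ^ 2) := by
      refine Finset.sum_congr rfl fun ρ hρ ↦ ?_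
      rw [hF₃, Finset.mem_filter] at hρ
      have : ¬ ρ.im < T - s := by intro hlt; linarith [hρ.2]
      have hk : κ ρ = 1 / (1 + (ρ.im - 2 * T) ^ 2) := by simp only [hκ]; rw [if_neg this]
      rw [hk]; ring
    rw [e]
    have h := sum_order_div_kernel_above_le (u₀ := 2 * T + s - 1) (d := s - 1) (by linarith) (by linarith) F₃
      fun ρ hρ ↦ by
        rw [hF₃, Finset.mem_filter] at hρ; exact ⟨(hF ρ hρ.1).1, by linarith [hρ.2]⟩
    refine h.trans ?_
    have hl1 : Real.log (2 * T + s - 1 + 2) ≤ Real.log (3 * T + 3) :=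
      Real.log_le_log (by linarith) (by linarith)
    have hl2 : Real.log (s - 1 + 2) ≤ Real.log (3 * T + 3) := Real.log_le_log (by linarith) (by linarith)
    have hl01 : 0 ≤ Real.log (2 * T + s - 1 + 2) := Real.log_nonneg (by linarith)
    have hl02 : 0 ≤ Real.log (s - 1 + 2) := Real.log_nonneg (by linarith)
    rw [show s - 1 + 1 = s by ring, div_le_div_iff₀ (by positivity) (by positivity)]
    nlinarith
  -- assemble
  have hκ0 : ∀ ρ, 0 ≤ κ ρ := fun ρ ↦ by simp only [hκ]; split_ifs <;> positivity
  calc ∑ ρ ∈ F, (riemannZetaZeroOrder ρ : ℝ) *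
          ∑ k : Fin (gridDim T), ‖hat (fun u ↦ (phi ψ T u : ℂ)) (gammaOf ρ - grid T (logHeight T) ((k : ℕ) : ℤ))‖ ^ 2
      ≤ ∑ ρ ∈ F, (riemannZetaZeroOrder ρ : ℝ) * (2 * C ^ 2 * L * κ ρ) :=
        Finset.sum_le_sum fun ρ hρ ↦ mul_le_mul_of_nonneg_left (hper ρ hρ) (hm0 ρ hρ)
    _ = 2 * C ^ 2 * L * ∑ ρ ∈ F, (riemannZetaZeroOrder ρ : ℝ) * κ ρ := by
        rw [Finset.mul_sum]; refine Finset.sum_congr rfl fun ρ _ ↦ by ring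
    _ ≤ 2 * C ^ 2 * L * (48 * (2 * L) / s + 24 * (2 * L) / s + 48 * (2 * L) / s) := by
        rw [hsplit]
        refine mul_le_mul_of_nonneg_left ?_ (by positivity)
        linarith
    _ = 480 * C ^ 2 * L ^ 2 / s := by ring

open AlpogeFurman2026 in
/-- **[AF26] Proposition 4.3, normalised** (`‖Ẽ‖₁ ≪ T^{−1/2}`, partial sums): for a window `ψ` there
is `C` with `(L∫φ_T²)⁻¹ Σ_{ρ∈F} m_ρ Σ_k |φ̂(γ_ρ − α_k)|² ≤ C/√T` for all `T ≥ 300` with `L ≥ 10` and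
every finite set `F` of far zeros — here `L∫φ_T² = aL²` is the normalisation of (2.10)
(`gramWeight ψ T = (aL²)⁻¹`, `gramWeight_eq_inv`), bounded below by `m₀L²/2` (`normalisation_ge`).
[cite: AlpogeFurman2026, Proposition 4.3 (p. 7)] -/
theorem AlpogeFurman2026_tail_partial_sum_normalised {ψ : ℝ → ℝ} (hψ : IsWindow ψ) :
    ∃ C : ℝ, 0 ≤ C ∧ ∀ T : ℝ, 300 ≤ T → 10 ≤ logHeight T →
      ∀ F : Finset ℂ, (∀ ρ ∈ F, ρ ∈ ZetaZeros.riemannZetaNontrivialZeros ∧ ρ ∉ nearZeros T) →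
        (logHeight T * ∫ u : ℝ, phi ψ T u ^ 2)⁻¹ *
          ∑ ρ ∈ F, (riemannZetaZeroOrder ρ : ℝ) *
            ∑ k : Fin (gridDim T), ‖hat (fun u ↦ (phi ψ T u : ℂ))
              (gammaOf ρ - grid T (logHeight T) ((k : ℕ) : ℤ))‖ ^ 2 ≤
          C / Real.sqrt T := by
  obtain ⟨C, hC0, hC⟩ := AlpogeFurman2026_tail_partial_sum hψ
  obtain ⟨m₀, B, K, hm₀, -, -, hfloor, -, -⟩ := hψ.exists_bounds
  refine ⟨2 * C / m₀, by positivity, fun T hT hL F hF ↦ ?_⟩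
  have h := hC T hT hL F hF
  have hM := normalisation_ge hψ hm₀ hfloor (T := T) (by linarith)
  set M := logHeight T * ∫ u : ℝ, phi ψ T u ^ 2 with hMdef
  set L := logHeight T with hLdef
  have hL0 : 0 < L := by linarith
  have hMpos : 0 < M := lt_of_lt_of_le (by positivity) hM
  have hs0 : 0 < Real.sqrt T := Real.sqrt_pos.2 (by linarith)
  rw [inv_mul_le_iff₀ hMpos]
  refine h.trans ?_
  -- `C L²/√T ≤ M · (2C/m₀)/√T` since `M ≥ m₀ L²/2`
  rw [div_le_iff₀ hs0, show M * (2 * C / m₀ / Real.sqrt T) * Real.sqrt T = M * (2 * C / m₀) by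
    field_simp]
  rw [show M * (2 * C / m₀) = (2 * M) * C / m₀ by ring, le_div_iff₀ hm₀]
  have h2 : m₀ * L ^ 2 ≤ 2 * M := by linarith
  nlinarith [h2, hC0]

end Literature.NumberTheory.LFunctions

end
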